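/-
Copyright (c) 2026 the pub-hodgecm-mathlib formalisation cell (harness21).  Prover seat hodgecm-mathlib-K2Liu-p12 (g2): Track B «K2-LIT»,
#184♮ = hLiu418 = stmt-HodgeConjecture-24832; Road Φ of socket #41, organ Φ4-EXACT (LEAD F0P6-plan ruling «M-157p»), file E1a.
-/
import Summits.HodgeConjecture.HodgeConjecture.Theorems.K2LiuHerm2ContentExact        -- ★ E0: the exact content at a place `w`
import Summits.HodgeConjecture.HodgeConjecture.Theorems.K2LiuGKRankOneValue          -- ★ `chi_eq_of_valued_eq_one`, `norm_eq_one_of_valued_eq_one'`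
import Summits.HodgeConjecture.HodgeConjecture.Theorems.K2LiuLocalRingValuationBalls  -- ★ F3c-1: ball letter, `valued_toPlace_uniformizer_gal`
import HarnessLib

/-!
# Crux `HLiu418`, Road Φ of socket #41, organ Φ4-EXACT — FILE E1a: THE CONTENT PROFILE OF THE SPHERICAL SECTION AT RANK TWO

Cell `hodgecm-mathlib`, crux item hLiu418 = `stmt-HodgeConjecture-24832`, route of record `HCCMUnconditional`; squad K2 ∕ K2Liu, road `K2_Liu`,
socket #41 `sig_K2LiuSiegelEisensteinContinuation`, Road Φ, organ Φ4-EXACT (ruling M-157p; method memo `K2/K2Liu-p12/g2/CENSUS-PHI4-EXACT-Method.K2Liu-p12-g2.md`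
§1 (a)–(b)).  THEOREMS ONLY (no `def`, no `instance`, no `notation`, no named-fact hypothesis, no `sorry`); lane `--supports stmt-HodgeConjecture-24832`
(count-neutral helper; closes no socket by itself).

WHAT IS PROVED.  `n = 2`, `w_Δ n(X) = p k` an Iwasawa factorisation (`p ∈ P_Δ(F_v)`, `k ∈ K_v`), `|2|_w = 1` at every `w ∣ v`, `ϖ` a uniformizer of `F_v`
with `v_w(ι_w ϖ) = exp(−1)` at every `w ∣ v` (the place is UNRAMIFIED in `E`).
* §1 discreteness: `|x|_w ≤ |ϖ|^a` and `¬ |x|_w ≤ |ϖ|^{a+1}` force `|x|_w = |ϖ|^a`.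
* §2 **symmetry of the content across the places above `v`**: `|det_Δ p|_w = |det_Δ p|_{w'}` for all `w, w' ∣ v` — from the group structure only:
  `det(matA p) = det A · det D` has valuation `1` at every place (`det matA(w_Δ n X)` and `det matA k` are units), and `σ(det D)·det A = 1`
  (★ `map_det_blkD_mul_det_blkA'`) reads `|det A|_w = |det D|_{c⁻¹w}⁻¹ = |det A|_{c⁻¹w}`; the fibre is `{w, c⁻¹w}` (★ `PlacesOver.eq_or_eq_galInv`).
* §3 **pinning**: on the SHELL `‖X‖ = q^a` with `|det X| ≤ q^a` (`a ≥ 0`): `|det_Δ p|_w = |ϖ|_w^a` at EVERY `w`; on the DET LEVEL `|det X| = q^b`,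
  `‖X‖ ≤ q^a`, `a ≤ b`: `|det_Δ p|_w = |ϖ|_w^b` at every `w`; on the unit ball `|det_Δ p|_w = 1` (★ E0 at the witnessing place, then §2).
* §4 **the profile**: if `|det_Δ p|_w = |ϖ|_w^e` at every `w` then `χ_v(det_Δ p)|det_Δ p|_v^{s+1} = t^e`,
  **`t := (∏_{w∣v} χ_w(ι_w ϖ)) · (∏_{w∣v} ‖ι_w ϖ‖_w)^{s+1}`** (letters of ★ `K2LiuGKRankOneValue`, exponent `s + n/2 = s + 1`), for `χ_w` unramified;
  hence the spherical section takes the value `t^e` at `w_Δ n(X)` on each content stratum (`apply_weylDelta_nElem_eq_pow_of_shell`,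
  `…_of_detLevel`, `…_of_unitBall`).  These are the pointwise inputs of the stratification of the unramified Whittaker coefficient (file E1b).

## References
* [Shimura1997] G. Shimura, *Euler Products and Eisenstein Series*, CBMS 93 (1997), §13.5–13.6, §18.
* [KudlaSweet1997] S. Kudla, W. J. Sweet, Israel J. Math. 98 (1997), §1.   * [Casselman1980] W. Casselman, Compositio Math. 40 (1980), §3.
* [HarrisKudlaSweet1996] M. Harris, S. Kudla, W. J. Sweet, J. AMS 9 (1996), §1 (1.11)–(1.15), §6 (6.14).
-/

set_option autoImplicit false
-- the mandated namespace repeats the single-problem summit's segment (`HodgeConjecture.HodgeConjecture`)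
set_option linter.dupNamespace false

noncomputable section

open scoped Matrix ValuativeRel
open NumberField IsDedekindDomain Matrix ValuativeRel
open Literature.NumberTheory.Automorphic Literature.NumberTheory.Automorphic.UnitaryGroup
open Literature.NumberTheory.GelbartRogawski1991.AdaptedBlocks
open Literature.NumberTheory.GelbartRogawski1991.UnitaryDualPair.LocalSplitting
open Literature.NumberTheory.K2Lit.LocalSiegelDoubled
open Summit.HodgeConjecture.HodgeConjecture.Cruxes.HLiu418.K2LiuSiegelLeviWeylAlgebra
open Summit.HodgeConjecture.HodgeConjecture.Cruxes.HLiu418.K2LiuSiegelWeylUnipotentContent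
open Summit.HodgeConjecture.HodgeConjecture.Cruxes.HLiu418.K2LiuHerm2ContentExact
open Summit.HodgeConjecture.HodgeConjecture.Cruxes.HLiu418.K2LiuGKRankOneValue
open Summit.HodgeConjecture.HodgeConjecture.Cruxes.HLiu418.K2LiuLocalRingValuationBalls

namespace Summit.HodgeConjecture.HodgeConjecture.Cruxes.HLiu418.K2LiuWhittakerContentProfile

/-! ## §1 Discreteness in an unramified completion -/

/-- **discreteness**: `|x| ≤ |ϖ|^a` and `¬ |x| ≤ |ϖ|^{a+1}` (`ϖ` a uniformizer) ⇒ `|x| = |ϖ|^a`. [cite: Shimura1997, §13.5] -/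
theorem valued_eq_zpow_of_le_of_not_le {K : Type*} [Field K] [Valued K (WithZero (Multiplicative ℤ))] {ϖ x : K}
    (hϖ : Valued.v ϖ = WithZero.exp (-1 : ℤ)) (a : ℤ)
    (h1 : Valued.v x ≤ Valued.v ϖ ^ a) (h2 : ¬ Valued.v x ≤ Valued.v ϖ ^ (a + 1)) : Valued.v x = Valued.v ϖ ^ a := by
  rw [hϖ, ← WithZero.exp_zsmul, smul_eq_mul, mul_neg_one] at h1 h2 ⊢
  have hx0 : Valued.v x ≠ 0 := fun h => h2 (by rw [h]; exact zero_le)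
  rw [← WithZero.exp_log hx0, WithZero.exp_le_exp] at h1 h2
  rw [← WithZero.exp_log hx0, WithZero.exp_inj]
  omega

/-- in `ℤᵐ⁰`, `γ · γ = 1 ⇒ γ = 1`. [folklore] -/
theorem eq_one_of_mul_self_eq_one {γ : WithZero (Multiplicative ℤ)} (h : γ * γ = 1) : γ = 1 := by
  rcases le_total γ 1 with hle | hge
  · refine le_antisymm hle ?_
    calc (1 : WithZero (Multiplicative ℤ)) = γ * γ := h.symm
      _ ≤ γ * 1 := mul_le_mul' le_rfl hle
      _ = γ := mul_one γ
  · refine le_antisymm ?_ hge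
    calc γ = γ * 1 := (mul_one γ).symm
      _ ≤ γ * γ := mul_le_mul' le_rfl hge
      _ = 1 := h

/-! ## §2 Symmetry of the content across the places above `v` (general `n`) -/

section General

variable (F : Type) [Field F] [NumberField F] (E : Type) [Field E] [NumberField E] [Algebra F E]
  [Algebra.IsQuadraticExtension F E] (c : E ≃ₐ[F] E) {δ : E} (hcδ : c δ = -δ) (hδ : δ ≠ 0) {dd : F} (hd : δ * δ = algebraMap F E dd)
  (v : HeightOneSpectrum (𝓞 F)) (n : ℕ) {T₀ : Matrix (Fin n) (Fin n) F} (hT₀ : T₀.IsSymm) (hT₀d : IsUnit T₀.det)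
  {JD : Matrix (Fin (n + n)) (Fin (n + n)) E} (hJD : JD = (gramD F n T₀).map (algebraMap F E))

omit [Algebra.IsQuadraticExtension F E] in
/-- `det (adapt M) = det M` (`adapt M = R⁻¹ M R`). [cite: HarrisKudlaSweet1996, §1 (1.11)] -/
theorem det_adapt (M : Matrix (Fin n ⊕ Fin n) (Fin n ⊕ Fin n) (LocalRing E v)) : (adapt M).det = M.det := by
  have h := congrArg Matrix.det (cayR_mul_cayRinv (L := LocalRing E v) (ι := Fin n))
  rw [Matrix.det_mul, Matrix.det_one] at h
  rw [adapt, Matrix.det_mul, Matrix.det_mul]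
  linear_combination M.det * h

omit [NumberField F] [Algebra.IsQuadraticExtension F E] in
/-- the determinant of a matrix over `E ⊗ F_v`, read at the place `w`, is the determinant of the `w`-component matrix. [folklore] -/
theorem det_apply_eq_det_map {m : Type*} [Fintype m] [DecidableEq m] (M : Matrix m m (LocalRing E v)) (w : PlacesOver E v) :
    M.det w = (M.map (Pi.evalRingHom (fun w' : PlacesOver E v => w'.1.adicCompletion E) w)).det := by
  rw [← RingHom.mapMatrix_apply, ← RingHom.map_det]; rfl

omit [Algebra.IsQuadraticExtension F E] in
/-- **`|det matA k|_w = 1` for `k ∈ K_v`** (`k`, `k⁻¹` have integral matrices at `w`). [cite: HarrisKudlaSweet1996, §1 (1.11)] -/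
theorem valued_det_matA_eq_one_of_mem_localInt {k : UnitaryGroup.localPi E c (n + n) JD v}
    (hk : k ∈ UnitaryGroup.localInt E c (n + n) JD v) (w : PlacesOver E v) : Valued.v ((matA F E c v n k).det w) = 1 := by
  have h1 : ∀ g ∈ UnitaryGroup.localInt E c (n + n) JD v, Valued.v ((matA F E c v n g).det w) ≤ 1 := fun g hg => by
    rw [v_le_one_iff_valuation_le_one, det_apply_eq_det_map F E v (matA F E c v n g) w]
    exact valuation_det_le_one (isIntegralAt_matA_of_mem_localInt' F E c v n hg w)
  have hprod : (matA F E c v n k).det w * (matA F E c v n k⁻¹).det w = 1 := by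
    rw [← Pi.mul_apply, ← Matrix.det_mul, matA_mul, mul_inv_cancel, matA_one, Matrix.det_one, Pi.one_apply]
  refine le_antisymm (h1 k hk) ?_
  have h := congrArg Valued.v hprod
  rw [map_mul, map_one] at h
  calc (1 : WithZero (Multiplicative ℤ)) = Valued.v ((matA F E c v n k).det w) * Valued.v ((matA F E c v n k⁻¹).det w) := h.symm
    _ ≤ Valued.v ((matA F E c v n k).det w) * 1 := mul_le_mul' le_rfl (h1 _ (Subgroup.inv_mem _ hk))
    _ = Valued.v ((matA F E c v n k).det w) := mul_one _

include hJD in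
omit [Algebra.IsQuadraticExtension F E] in
/-- **`|det matA (w_Δ n(X))|_w = 1`**: `det matA n(X) = det (1 X; 0 1) = 1` and `(det matA w_Δ)² = det matA (w_Δ²) = 1`. [cite: Kudla1994, §3] -/
theorem valued_det_matA_weylDelta_mul_nElem (X : Matrix (Fin n) (Fin n) (LocalRing E v))
    (hX : (X.map (conjLocal E c v))ᵀ * gramS F E v n T₀ + gramS F E v n T₀ * X = 0) (w : PlacesOver E v) :
    Valued.v ((matA F E c v n (weylDelta F E c v n hJD * nElem F E c v n hJD X hX)).det w) = 1 := by
  have hn : (matA F E c v n (nElem F E c v n hJD X hX)).det = 1 := by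
    rw [← det_adapt F E v n, adapt_matA_nElem, Matrix.det_fromBlocks_zero₂₁, Matrix.det_one, mul_one]
  have hw2 : (matA F E c v n (weylDelta F E c v n hJD)).det * (matA F E c v n (weylDelta F E c v n hJD)).det = 1 := by
    rw [← Matrix.det_mul, matA_mul, weylDelta_mul_self, matA_one, Matrix.det_one]
  have hw : Valued.v ((matA F E c v n (weylDelta F E c v n hJD)).det w) = 1 := by
    apply eq_one_of_mul_self_eq_one
    rw [← map_mul, ← Pi.mul_apply, hw2, Pi.one_apply, map_one]
  rw [← matA_mul, Matrix.det_mul, Pi.mul_apply, map_mul, hw, hn, Pi.one_apply, map_one, mul_one]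

include hT₀d hJD in
omit [Algebra.IsQuadraticExtension F E] in
/-- **symmetry of the content**: for `w_Δ n(X) = p k` with `C(p) = 0`, `k ∈ K_v`:  `|det_Δ p|_w = |det_Δ p|_{c⁻¹ w}`.
[cite: HarrisKudlaSweet1996, §1 (1.11)–(1.15)] [cite: Shimura1997, §13.6] -/
theorem valued_detDelta_eq_galInv (X : Matrix (Fin n) (Fin n) (LocalRing E v))
    (hX : (X.map (conjLocal E c v))ᵀ * gramS F E v n T₀ + gramS F E v n T₀ * X = 0)
    {p k : UnitaryGroup.localPi E c (n + n) JD v} (hC : blkC (matA F E c v n p) = 0)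
    (hk : k ∈ UnitaryGroup.localInt E c (n + n) JD v) (hg : weylDelta F E c v n hJD * nElem F E c v n hJD X hX = p * k)
    (w : PlacesOver E v) :
    Valued.v (detDelta F E c v n w p) = Valued.v (detDelta F E c v n (PlacesOver.galInv c w) p) := by
  -- `det matA p = det A · det D` has valuation `1` at every place
  have hAD : ∀ w' : PlacesOver E v,
      Valued.v ((blkA (matA F E c v n p)).det w') * Valued.v ((blkD (matA F E c v n p)).det w') = 1 := by
    intro w'
    have hdet : (matA F E c v n p).det = (blkA (matA F E c v n p)).det * (blkD (matA F E c v n p)).det := by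
      rw [← det_adapt F E v n (matA F E c v n p), adapt_eq, hC, Matrix.det_fromBlocks_zero₂₁]
    have hgk : (matA F E c v n (weylDelta F E c v n hJD * nElem F E c v n hJD X hX)).det =
        (matA F E c v n p).det * (matA F E c v n k).det := by rw [hg, ← matA_mul, Matrix.det_mul]
    have h := valued_det_matA_weylDelta_mul_nElem F E c v n hJD X hX w'
    rw [hgk, Pi.mul_apply, map_mul, valued_det_matA_eq_one_of_mem_localInt F E c v n hk w', mul_one, hdet, Pi.mul_apply, map_mul] at h
    exact h
  -- `σ(det D) · det A = 1`, read at `w`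
  have hrel := map_det_blkD_mul_det_blkA' F E c v n hT₀d hJD hC
  have hrel' : Valued.v ((blkD (matA F E c v n p)).det (PlacesOver.galInv c w)) * Valued.v ((blkA (matA F E c v n p)).det w) = 1 := by
    have h := congrArg (fun r : LocalRing E v => Valued.v (r w)) hrel
    simp only [Pi.mul_apply, Pi.one_apply, map_mul, map_one, conjLocal_apply, valued_galAdicCompletionMap] at h
    exact h
  -- compare with `hAD` at `c⁻¹ w`
  have h2 := hAD (PlacesOver.galInv c w)
  rw [detDelta_levi F E c v n hC w, detDelta_levi F E c v n hC (PlacesOver.galInv c w)]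
  have hD0 : Valued.v ((blkD (matA F E c v n p)).det (PlacesOver.galInv c w)) ≠ 0 := by
    intro h0; rw [h0, mul_zero] at h2; exact zero_ne_one h2
  rw [mul_comm] at hrel'
  exact mul_right_cancel₀ hD0 (hrel'.trans h2.symm)

include hcδ hδ hT₀d hJD in
/-- **`|det_Δ p|_w = |det_Δ p|_{w'}` for all places `w, w'` above `v`** (the fibre is `{w, c⁻¹ w}`). [cite: HarrisKudlaSweet1996, §1 (1.15)] -/
theorem valued_detDelta_eq_of_factor (X : Matrix (Fin n) (Fin n) (LocalRing E v))
    (hX : (X.map (conjLocal E c v))ᵀ * gramS F E v n T₀ + gramS F E v n T₀ * X = 0)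
    {p k : UnitaryGroup.localPi E c (n + n) JD v} (hC : blkC (matA F E c v n p) = 0)
    (hk : k ∈ UnitaryGroup.localInt E c (n + n) JD v) (hg : weylDelta F E c v n hJD * nElem F E c v n hJD X hX = p * k)
    (w w' : PlacesOver E v) : Valued.v (detDelta F E c v n w p) = Valued.v (detDelta F E c v n w' p) := by
  rcases PlacesOver.eq_or_eq_galInv c (galConj_ne_one_of_delta F E c hcδ hδ) w w' with rfl | rfl
  · rfl
  · exact valued_detDelta_eq_galInv F E c v n hT₀d hJD X hX hC hk hg w

end General

/-! ## §3 Pinning the content on the strata (`n = 2`) -/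

section RankTwo

variable (F : Type) [Field F] [NumberField F] (E : Type) [Field E] [NumberField E] [Algebra F E]
  [Algebra.IsQuadraticExtension F E] (c : E ≃ₐ[F] E) {δ : E} (hcδ : c δ = -δ) (hδ : δ ≠ 0) {dd : F} (hd : δ * δ = algebraMap F E dd)
  (v : HeightOneSpectrum (𝓞 F)) {T₀ : Matrix (Fin 2) (Fin 2) F} (hT₀ : T₀.IsSymm) (hT₀d : IsUnit T₀.det)
  {JD : Matrix (Fin (2 + 2)) (Fin (2 + 2)) E} (hJD : JD = (gramD F 2 T₀).map (algebraMap F E))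
  {π : v.adicCompletion F} (hπw : ∀ w : PlacesOver E v, Valued.v (toPlace v w π) = WithZero.exp (-1 : ℤ))

include hcδ hδ hd hT₀ hT₀d hJD hπw in
/-- **SHELL**: if `‖X‖ ≤ q^a`, `|det X| ≤ q^a` (all `w`), `a ≥ 0`, and some entry is NOT in the ball `q^{a−1}`, then `|det_Δ p|_w = |ϖ|_w^a` at EVERY `w`.
[cite: Shimura1997, §13.6] [cite: KudlaSweet1997, §1] -/
theorem valued_detDelta_eq_of_shell
    (X : Matrix (Fin 2) (Fin 2) (LocalRing E v)) (hX : (X.map (conjLocal E c v))ᵀ * gramS F E v 2 T₀ + gramS F E v 2 T₀ * X = 0)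
    {p k : UnitaryGroup.localPi E c (2 + 2) JD v} (hp : IsSiegelDelta F E c hcδ hδ hd v 2 hT₀ hJD p)
    (hk : k ∈ UnitaryGroup.localInt E c (2 + 2) JD v) (hg : weylDelta F E c v 2 hJD * nElem F E c v 2 hJD X hX = p * k)
    (h2 : ∀ w : PlacesOver E v, valuation (w.1.adicCompletion E) (2 : w.1.adicCompletion E) = 1)
    {a : ℕ} (hXa : ∀ i j (w : PlacesOver E v), Valued.v (X i j w) ≤ Valued.v (toPlace v w π) ^ (-(a : ℤ)))
    (hXd : ∀ w : PlacesOver E v, Valued.v (X.det w) ≤ Valued.v (toPlace v w π) ^ (-(a : ℤ)))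
    (hwit : ∃ (i j : Fin 2) (w : PlacesOver E v), ¬ Valued.v (X i j w) ≤ Valued.v (toPlace v w π) ^ (-(a : ℤ) + 1)) :
    ∀ w : PlacesOver E v, Valued.v (detDelta F E c v 2 w p) = Valued.v (toPlace v w π) ^ a := by
  obtain ⟨i₀, j₀, w₀, hn⟩ := hwit
  have hex : Valued.v (X i₀ j₀ w₀) = Valued.v (toPlace v w₀ π) ^ (-(a : ℤ)) :=
    valued_eq_zpow_of_le_of_not_le (hπw w₀) (-(a : ℤ)) (hXa i₀ j₀ w₀) hn
  have hπ0 : Valued.v (toPlace v w₀ π) ≠ 0 := by rw [hπw]; exact WithZero.coe_ne_zero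
  have h1 : 1 ≤ Valued.v (X i₀ j₀ w₀) := by
    rw [hex, hπw, ← WithZero.exp_zsmul, smul_eq_mul, mul_neg_one, neg_neg, ← WithZero.exp_zero, WithZero.exp_le_exp]
    positivity
  have hpin := v_detDelta_mul_apply_eq_one F E c hcδ hδ hd v hT₀ hJD X hX hp hk hg w₀ (h2 w₀) i₀ j₀ h1
    (fun i j => by rw [hex]; exact hXa i j w₀) (by rw [hex]; exact hXd w₀)
  rw [map_mul, hex] at hpin
  have hw₀ : Valued.v (detDelta F E c v 2 w₀ p) = Valued.v (toPlace v w₀ π) ^ a := by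
    have h : Valued.v (detDelta F E c v 2 w₀ p) * Valued.v (toPlace v w₀ π) ^ (-(a : ℤ)) * Valued.v (toPlace v w₀ π) ^ (a : ℤ) =
        Valued.v (toPlace v w₀ π) ^ (a : ℤ) := by rw [hpin, one_mul]
    rwa [mul_assoc, ← zpow_add₀ hπ0, neg_add_cancel, zpow_zero, mul_one, zpow_natCast] at h
  intro w
  have hC : blkC (matA F E c v 2 p) = 0 := (isSiegelDelta_iff_blkC_eq_zero F E c hcδ hδ hd v 2 hT₀ hJD p).1 hp
  rw [valued_detDelta_eq_of_factor F E c hcδ hδ v 2 hT₀d hJD X hX hC hk hg w w₀, hw₀, hπw w, hπw w₀]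

include hcδ hδ hd hT₀ hT₀d hJD hπw in
/-- **DET LEVEL**: if `‖X‖ ≤ q^a`, `|det X| ≤ q^b` (all `w`), `a ≤ b`, and at some place `|det X| > q^{b−1}`, then `|det_Δ p|_w = |ϖ|_w^b` at EVERY `w`.
[cite: Shimura1997, §13.6] [cite: KudlaSweet1997, §1] -/
theorem valued_detDelta_eq_of_detLevel
    (X : Matrix (Fin 2) (Fin 2) (LocalRing E v)) (hX : (X.map (conjLocal E c v))ᵀ * gramS F E v 2 T₀ + gramS F E v 2 T₀ * X = 0)
    {p k : UnitaryGroup.localPi E c (2 + 2) JD v} (hp : IsSiegelDelta F E c hcδ hδ hd v 2 hT₀ hJD p)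
    (hk : k ∈ UnitaryGroup.localInt E c (2 + 2) JD v) (hg : weylDelta F E c v 2 hJD * nElem F E c v 2 hJD X hX = p * k)
    (h2 : ∀ w : PlacesOver E v, valuation (w.1.adicCompletion E) (2 : w.1.adicCompletion E) = 1)
    {a b : ℕ} (hab : a ≤ b) (hXa : ∀ i j (w : PlacesOver E v), Valued.v (X i j w) ≤ Valued.v (toPlace v w π) ^ (-(a : ℤ)))
    (hXd : ∀ w : PlacesOver E v, Valued.v (X.det w) ≤ Valued.v (toPlace v w π) ^ (-(b : ℤ)))
    (hwit : ∃ w : PlacesOver E v, ¬ Valued.v (X.det w) ≤ Valued.v (toPlace v w π) ^ (-(b : ℤ) + 1)) :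
    ∀ w : PlacesOver E v, Valued.v (detDelta F E c v 2 w p) = Valued.v (toPlace v w π) ^ b := by
  obtain ⟨w₀, hn⟩ := hwit
  have hex : Valued.v (X.det w₀) = Valued.v (toPlace v w₀ π) ^ (-(b : ℤ)) :=
    valued_eq_zpow_of_le_of_not_le (hπw w₀) (-(b : ℤ)) (hXd w₀) hn
  have hπ0 : Valued.v (toPlace v w₀ π) ≠ 0 := by rw [hπw]; exact WithZero.coe_ne_zero
  have hπ1 : Valued.v (toPlace v w₀ π) ≤ 1 := by
    rw [hπw, ← WithZero.exp_zero, WithZero.exp_le_exp]; norm_num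
  have h1 : 1 ≤ Valued.v (X.det w₀) := by
    rw [hex, hπw, ← WithZero.exp_zsmul, smul_eq_mul, mul_neg_one, neg_neg, ← WithZero.exp_zero, WithZero.exp_le_exp]
    positivity
  have hmax : ∀ i j, Valued.v (X i j w₀) ≤ Valued.v (X.det w₀) := fun i j => by
    rw [hex]
    exact (hXa i j w₀).trans (zpow_le_zpow_right_of_le_one₀ (zero_lt_iff.2 hπ0) hπ1 (by omega))
  have hpin := v_detDelta_mul_det_eq_one F E c hcδ hδ hd v hT₀ hJD X hX hp hk hg w₀ (h2 w₀) h1 hmax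
  rw [map_mul, hex] at hpin
  have hw₀ : Valued.v (detDelta F E c v 2 w₀ p) = Valued.v (toPlace v w₀ π) ^ b := by
    have h : Valued.v (detDelta F E c v 2 w₀ p) * Valued.v (toPlace v w₀ π) ^ (-(b : ℤ)) * Valued.v (toPlace v w₀ π) ^ (b : ℤ) =
        Valued.v (toPlace v w₀ π) ^ (b : ℤ) := by rw [hpin, one_mul]
    rwa [mul_assoc, ← zpow_add₀ hπ0, neg_add_cancel, zpow_zero, mul_one, zpow_natCast] at h
  intro w
  have hC : blkC (matA F E c v 2 p) = 0 := (isSiegelDelta_iff_blkC_eq_zero F E c hcδ hδ hd v 2 hT₀ hJD p).1 hp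
  rw [valued_detDelta_eq_of_factor F E c hcδ hδ v 2 hT₀d hJD X hX hC hk hg w w₀, hw₀, hπw w, hπw w₀]

include hcδ hδ hd hT₀ hJD in
/-- **UNIT BALL**: if `X` is integral at every `w` then `|det_Δ p|_w = 1` at every `w`. [cite: Casselman1980, §3] [cite: Shimura1997, §13.6] -/
theorem valued_detDelta_eq_of_unitBall
    (X : Matrix (Fin 2) (Fin 2) (LocalRing E v)) (hX : (X.map (conjLocal E c v))ᵀ * gramS F E v 2 T₀ + gramS F E v 2 T₀ * X = 0)
    {p k : UnitaryGroup.localPi E c (2 + 2) JD v} (hp : IsSiegelDelta F E c hcδ hδ hd v 2 hT₀ hJD p)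
    (hk : k ∈ UnitaryGroup.localInt E c (2 + 2) JD v) (hg : weylDelta F E c v 2 hJD * nElem F E c v 2 hJD X hX = p * k)
    (h2 : ∀ w : PlacesOver E v, valuation (w.1.adicCompletion E) (2 : w.1.adicCompletion E) = 1)
    (hX0 : ∀ i j (w : PlacesOver E v), Valued.v (X i j w) ≤ 1) :
    ∀ w : PlacesOver E v, Valued.v (detDelta F E c v 2 w p) = 1 := by
  intro w
  have hXd : Valued.v (X.det w) ≤ 1 := by
    rw [v_le_one_iff_valuation_le_one, det_apply_eq_det_map F E v X w]
    exact valuation_det_le_one fun i j => (v_le_one_iff_valuation_le_one _).1 (hX0 i j w)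
  exact v_detDelta_eq_one_of_integral F E c hcδ hδ hd v hT₀ hJD X hX hp hk hg w (h2 w) (fun i j => hX0 i j w) hXd

/-! ## §4 The profile `χ_v(det_Δ p)|det_Δ p|_v^{s+1} = t^e` -/

omit [Algebra.IsQuadraticExtension F E] in
/-- **THE PROFILE.**  If `|det_Δ p|_w = |ι_w ϖ|_w^e` at every `w ∣ v` and `χ_w` is unramified at every `w`, then
`χ_v(det_Δ p) · |det_Δ p|_v^{s+1} = ((∏_w χ_w(ι_w ϖ)) · (∏_w ‖ι_w ϖ‖_w)^{s+1})^e`.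
[cite: HarrisKudlaSweet1996, §6 (6.14)] [cite: Casselman1980, §3] [cite: Shimura1997, §13.6] -/
theorem localSiegelCharacter_eq_pow (χv : ∀ w : PlacesOver E v, (w.1.adicCompletion E)ˣ →* ℂˣ)
    (hχ : ∀ (w : PlacesOver E v) (u : (w.1.adicCompletion E)ˣ), Valued.v (u : w.1.adicCompletion E) = 1 → χv w u = 1)
    (s : ℂ) (hϖ0 : ∀ w : PlacesOver E v, toPlace v w π ≠ 0) {p : UnitaryGroup.localPi E c (2 + 2) JD v} (e : ℕ)
    (hv : ∀ w : PlacesOver E v, Valued.v (detDelta F E c v 2 w p) = Valued.v (toPlace v w π) ^ e) :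
    localSiegelCharacter F E c v 2 χv s p =
      ((((∏ w : PlacesOver E v, χv w (Units.mk0 (toPlace v w π) (hϖ0 w))) : ℂˣ) : ℂ) *
          (((∏ w : PlacesOver E v, ‖toPlace v w π‖) : ℝ) : ℂ) ^ (s + 1)) ^ e := by
  -- the unit factors `r_w := det_Δ p_w / ι_w(ϖ)^e`
  have hπe : ∀ w : PlacesOver E v, toPlace v w π ^ e ≠ 0 := fun w => pow_ne_zero _ (hϖ0 w)
  have hfac : ∀ w : PlacesOver E v, detDelta F E c v 2 w p = toPlace v w π ^ e * (detDelta F E c v 2 w p / toPlace v w π ^ e) :=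
    fun w => by rw [mul_div_cancel₀ _ (hπe w)]
  have hr : ∀ w : PlacesOver E v, Valued.v (detDelta F E c v 2 w p / toPlace v w π ^ e) = 1 := fun w => by
    have h0 : Valued.v (toPlace v w π) ^ e ≠ 0 := pow_ne_zero _ ((Valuation.ne_zero_iff _).2 (hϖ0 w))
    rw [map_div₀, map_pow, hv w, div_self h0]
  have hr0 : ∀ w : PlacesOver E v, detDelta F E c v 2 w p / toPlace v w π ^ e ≠ 0 := fun w h => by
    have h1 := hr w
    rw [h, map_zero] at h1
    exact zero_ne_one h1
  have hunit : ∀ w : PlacesOver E v, IsUnit (detDelta F E c v 2 w p) := fun w => by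
    rw [hfac w]; exact ((IsUnit.mk0 _ (hϖ0 w)).pow _).mul (IsUnit.mk0 _ (hr0 w))
  -- `χ_v(det_Δ p) = α^e`
  have hchi : chiDet F E c v 2 χv p = (∏ w : PlacesOver E v, χv w (Units.mk0 (toPlace v w π) (hϖ0 w))) ^ e := by
    unfold chiDet
    rw [← Finset.prod_pow]
    refine Finset.prod_congr rfl fun w _ => ?_
    rw [dif_pos (hunit w), ← map_pow]
    refine chi_eq_of_valued_eq_one E (χv w) (hχ w) _ _ ?_
    rw [Units.val_mul, Units.val_inv_eq_inv_val, Units.val_pow_eq_pow_val, Units.val_mk0, IsUnit.unit_spec, ← div_eq_mul_inv]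
    exact hr w
  -- `|det_Δ p|_v = P^e`
  have habs : absDetDelta F E c v 2 p = (∏ w : PlacesOver E v, ‖toPlace v w π‖) ^ e := by
    unfold absDetDelta
    rw [← Finset.prod_pow]
    refine Finset.prod_congr rfl fun w _ => ?_
    rw [hfac w, norm_mul, norm_pow, norm_eq_one_of_valued_eq_one' E (hr w), mul_one]
  -- assemble `α^e (P^e)^{s+1} = (α P^{s+1})^e`
  have hP0 : 0 < ∏ w : PlacesOver E v, ‖toPlace v w π‖ := Finset.prod_pos fun w _ => norm_pos_iff.2 (hϖ0 w)
  unfold localSiegelCharacter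
  rw [hchi, habs, Units.val_pow_eq_pow_val, mul_pow]
  congr 1
  have hPn : ((((∏ w : PlacesOver E v, ‖toPlace v w π‖) ^ e : ℝ)) : ℂ) ≠ 0 := by exact_mod_cast (pow_pos hP0 _).ne'
  have hP0' : (((∏ w : PlacesOver E v, ‖toPlace v w π‖) : ℝ) : ℂ) ≠ 0 := by exact_mod_cast hP0.ne'
  rw [Complex.cpow_def_of_ne_zero hPn, Complex.cpow_def_of_ne_zero hP0', ← Complex.exp_nat_mul, ← Complex.ofReal_log (pow_pos hP0 _).le,
    Real.log_pow, ← Complex.ofReal_log hP0.le]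
  push_cast
  ring_nf

include hcδ hδ hd hT₀ hT₀d hJD hπw in
/-- **THE SPHERICAL SECTION ON A SHELL STRATUM**: `φ_s(w_Δ n(X)) = t^a` when `‖X‖ = q^a ≥ |det X|` (`t` as in `localSiegelCharacter_eq_pow`).
[cite: Shimura1997, §13.6, §18] [cite: KudlaSweet1997, §1] [cite: Casselman1980, §3] -/
theorem apply_weylDelta_nElem_eq_pow_of_shell (χv : ∀ w : PlacesOver E v, (w.1.adicCompletion E)ˣ →* ℂˣ)
    (hχ : ∀ (w : PlacesOver E v) (u : (w.1.adicCompletion E)ˣ), Valued.v (u : w.1.adicCompletion E) = 1 → χv w u = 1)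
    (s : ℂ) {φ : UnitaryGroup.localPi E c (2 + 2) JD v → ℂ} (hφ : IsSphericalSection F E c hcδ hδ hd v 2 hT₀ hJD χv s φ)
    (hϖ0 : ∀ w : PlacesOver E v, toPlace v w π ≠ 0)
    (h2 : ∀ w : PlacesOver E v, valuation (w.1.adicCompletion E) (2 : w.1.adicCompletion E) = 1)
    (X : Matrix (Fin 2) (Fin 2) (LocalRing E v)) (hX : (X.map (conjLocal E c v))ᵀ * gramS F E v 2 T₀ + gramS F E v 2 T₀ * X = 0)
    {p k : UnitaryGroup.localPi E c (2 + 2) JD v} (hp : IsSiegelDelta F E c hcδ hδ hd v 2 hT₀ hJD p)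
    (hk : k ∈ UnitaryGroup.localInt E c (2 + 2) JD v) (hg : weylDelta F E c v 2 hJD * nElem F E c v 2 hJD X hX = p * k)
    {a : ℕ} (hXa : ∀ i j (w : PlacesOver E v), Valued.v (X i j w) ≤ Valued.v (toPlace v w π) ^ (-(a : ℤ)))
    (hXd : ∀ w : PlacesOver E v, Valued.v (X.det w) ≤ Valued.v (toPlace v w π) ^ (-(a : ℤ)))
    (hwit : ∃ (i j : Fin 2) (w : PlacesOver E v), ¬ Valued.v (X i j w) ≤ Valued.v (toPlace v w π) ^ (-(a : ℤ) + 1)) :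
    φ (weylDelta F E c v 2 hJD * nElem F E c v 2 hJD X hX) =
      ((((∏ w : PlacesOver E v, χv w (Units.mk0 (toPlace v w π) (hϖ0 w))) : ℂˣ) : ℂ) *
          (((∏ w : PlacesOver E v, ‖toPlace v w π‖) : ℝ) : ℂ) ^ (s + 1)) ^ a := by
  rw [hg, hφ.apply_siegel_mul_localInt hp hk]
  exact localSiegelCharacter_eq_pow F E c v χv hχ s hϖ0 a
    (valued_detDelta_eq_of_shell F E c hcδ hδ hd v hT₀ hT₀d hJD hπw X hX hp hk hg h2 hXa hXd hwit)

include hcδ hδ hd hT₀ hT₀d hJD hπw in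
/-- **THE SPHERICAL SECTION ON A DET-LEVEL STRATUM**: `φ_s(w_Δ n(X)) = t^b` when `|det X| = q^b ≥ ‖X‖`. [cite: Shimura1997, §13.6, §18] [cite: KudlaSweet1997, §1] -/
theorem apply_weylDelta_nElem_eq_pow_of_detLevel (χv : ∀ w : PlacesOver E v, (w.1.adicCompletion E)ˣ →* ℂˣ)
    (hχ : ∀ (w : PlacesOver E v) (u : (w.1.adicCompletion E)ˣ), Valued.v (u : w.1.adicCompletion E) = 1 → χv w u = 1)
    (s : ℂ) {φ : UnitaryGroup.localPi E c (2 + 2) JD v → ℂ} (hφ : IsSphericalSection F E c hcδ hδ hd v 2 hT₀ hJD χv s φ)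
    (hϖ0 : ∀ w : PlacesOver E v, toPlace v w π ≠ 0)
    (h2 : ∀ w : PlacesOver E v, valuation (w.1.adicCompletion E) (2 : w.1.adicCompletion E) = 1)
    (X : Matrix (Fin 2) (Fin 2) (LocalRing E v)) (hX : (X.map (conjLocal E c v))ᵀ * gramS F E v 2 T₀ + gramS F E v 2 T₀ * X = 0)
    {p k : UnitaryGroup.localPi E c (2 + 2) JD v} (hp : IsSiegelDelta F E c hcδ hδ hd v 2 hT₀ hJD p)
    (hk : k ∈ UnitaryGroup.localInt E c (2 + 2) JD v) (hg : weylDelta F E c v 2 hJD * nElem F E c v 2 hJD X hX = p * k)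
    {a b : ℕ} (hab : a ≤ b) (hXa : ∀ i j (w : PlacesOver E v), Valued.v (X i j w) ≤ Valued.v (toPlace v w π) ^ (-(a : ℤ)))
    (hXd : ∀ w : PlacesOver E v, Valued.v (X.det w) ≤ Valued.v (toPlace v w π) ^ (-(b : ℤ)))
    (hwit : ∃ w : PlacesOver E v, ¬ Valued.v (X.det w) ≤ Valued.v (toPlace v w π) ^ (-(b : ℤ) + 1)) :
    φ (weylDelta F E c v 2 hJD * nElem F E c v 2 hJD X hX) =
      ((((∏ w : PlacesOver E v, χv w (Units.mk0 (toPlace v w π) (hϖ0 w))) : ℂˣ) : ℂ) *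
          (((∏ w : PlacesOver E v, ‖toPlace v w π‖) : ℝ) : ℂ) ^ (s + 1)) ^ b := by
  rw [hg, hφ.apply_siegel_mul_localInt hp hk]
  exact localSiegelCharacter_eq_pow F E c v χv hχ s hϖ0 b
    (valued_detDelta_eq_of_detLevel F E c hcδ hδ hd v hT₀ hT₀d hJD hπw X hX hp hk hg h2 hab hXa hXd hwit)

include hcδ hδ hd hT₀ hJD in
/-- **THE SPHERICAL SECTION ON THE UNIT BALL**: `φ_s(w_Δ n(X)) = 1` for `X` integral (twin of ★ X2's pointwise lemma, via the content).
[cite: Casselman1980, §3] [cite: Shimura1997, §18] -/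
theorem apply_weylDelta_nElem_eq_one_of_unitBall (χv : ∀ w : PlacesOver E v, (w.1.adicCompletion E)ˣ →* ℂˣ)
    (hχ : ∀ (w : PlacesOver E v) (u : (w.1.adicCompletion E)ˣ), Valued.v (u : w.1.adicCompletion E) = 1 → χv w u = 1)
    (s : ℂ) {φ : UnitaryGroup.localPi E c (2 + 2) JD v → ℂ} (hφ : IsSphericalSection F E c hcδ hδ hd v 2 hT₀ hJD χv s φ)
    (hϖ0 : ∀ w : PlacesOver E v, toPlace v w π ≠ 0)
    (h2 : ∀ w : PlacesOver E v, valuation (w.1.adicCompletion E) (2 : w.1.adicCompletion E) = 1)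
    (X : Matrix (Fin 2) (Fin 2) (LocalRing E v)) (hX : (X.map (conjLocal E c v))ᵀ * gramS F E v 2 T₀ + gramS F E v 2 T₀ * X = 0)
    {p k : UnitaryGroup.localPi E c (2 + 2) JD v} (hp : IsSiegelDelta F E c hcδ hδ hd v 2 hT₀ hJD p)
    (hk : k ∈ UnitaryGroup.localInt E c (2 + 2) JD v) (hg : weylDelta F E c v 2 hJD * nElem F E c v 2 hJD X hX = p * k)
    (hX0 : ∀ i j (w : PlacesOver E v), Valued.v (X i j w) ≤ 1) :
    φ (weylDelta F E c v 2 hJD * nElem F E c v 2 hJD X hX) = 1 := by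
  rw [hg, hφ.apply_siegel_mul_localInt hp hk, localSiegelCharacter_eq_pow F E c v χv hχ s hϖ0 0
    (fun w => by rw [pow_zero]; exact valued_detDelta_eq_of_unitBall F E c hcδ hδ hd v hT₀ hJD X hX hp hk hg h2 hX0 w), pow_zero]

end RankTwo


end Summit.HodgeConjecture.HodgeConjecture.Cruxes.HLiu418.K2LiuWhittakerContentProfile

end
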